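import Summits.CriticalPhenomena.PercolationContinuityZ3.Theorems.Transplant.Slab111VModel
import Summits.CriticalPhenomena.PercolationContinuityZ3.Theorems.Transplant.Slab111VShapes
import HarnessLib

/-!
# Paths in the `(111)`-films `F_k`, IV: the RELATIVE model around a block centre — shifted chains, block membership and peel codes in coordinates

builds on p205010 (kernel theorem, internal audit signed; external expert review pending) — NOT used in this file.  Lane `prim-bschramm`, seat
`prim-bschramm-p2` (gen 35; class C1b; memo `HOME/bschramm/P2-LATTICES.md` §129); helper file (`--supports stmt-CriticalPhenomena-4575 --as helper`).
The routing certificate for `ShapedLinkage 3 (Slab111.hexShadow k)` is searched and checked by the kernel on RELATIVE data: a model vertex `((a,b), λ)`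
stands for the film vertex over the column `z + (a,b)` at level `ℓ + λ`, where `z` is the block centre and `ℓ ≡ cls z (mod 3)` a reference level (so the
centre column carries the relative levels `≡ 0`).  This file is the dictionary:
* §1 `shiftMV z ℓ`, `absV k z ℓ` (the film vertex of a relative model vertex), `RAdm` (relative class condition), invariance of `MStep`, injectivity,
  **`gpath_of_relchain`** (a relative `MStep`-chain, duplicate-free, of admissible vertices in the level range, is a self-avoiding path of the film),
  `sh_absV`, `lev_absV`, `absV_inj`;
* §2 block membership in coordinates: `inBlkB` and `mem_blk_of_inBlkB` / `inBlkB_of_mem_blk`;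
* §3 the peel table in coordinates: `codesAt` (the level codes the table assigns to a relative column) and `peeled_iff_codes`; the consequences
  `not_peeled_of_mid` (levels `2 … k−2`: only code `4` matters) and the four boundary levels `0, 1, k−1, k`;
* §4 membership in the cleared set `Wset` from coordinates (`mem_Wset_of_codes_mid`, …).
[cite: DuminilCopinSidoraviciusTassion2016, §2.3 (proof of Fact 2: the ball B_R(z) and the paths γ_u, γ_v, γ_w)]
-/

noncomputable section

namespace Summit.CriticalPhenomena.PercolationContinuityZ3.Theorems.Transplant

open Literature.Probability.Percolation Literature.Probability.LatticeModels SimpleGraph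
open scoped Classical

namespace Slab111

variable {k : ℕ}

/-! ## §1 Relative model vertices -/

/-- The absolute model vertex of a relative one: column `z + (a,b)`, level `ℓ + λ`. [folklore] -/
def shiftMV (z : Site 2) (ℓ : ℤ) (p : MV) : MV := ((z 0 + p.1.1, z 1 + p.1.2), ℓ + p.2)

/-- **The film vertex of a relative model vertex.** [folklore] -/
def absV (k : ℕ) (z : Site 2) (ℓ : ℤ) (p : MV) : slab111 k := toV k (shiftMV z ℓ p)

/-- Relative admissibility: the relative level has the class of the relative column (`λ ≡ a + 2b (mod 3)`). [folklore] -/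
abbrev RAdm (p : MV) : Prop := (3 : ℤ) ∣ p.2 - (p.1.1 + 2 * p.1.2)

/-- Coordinates of `shiftMV`. [folklore] -/
@[simp] theorem shiftMV_fst_fst (z : Site 2) (ℓ : ℤ) (p : MV) : (shiftMV z ℓ p).1.1 = z 0 + p.1.1 := rfl
/-- Coordinates of `shiftMV`. [folklore] -/
@[simp] theorem shiftMV_fst_snd (z : Site 2) (ℓ : ℤ) (p : MV) : (shiftMV z ℓ p).1.2 = z 1 + p.1.2 := rfl
/-- Coordinates of `shiftMV`. [folklore] -/
@[simp] theorem shiftMV_snd (z : Site 2) (ℓ : ℤ) (p : MV) : (shiftMV z ℓ p).2 = ℓ + p.2 := rfl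

/-- `MStep` is translation invariant. [folklore] -/
theorem mstep_shift_iff (z : Site 2) (ℓ : ℤ) (p p' : MV) : MStep (shiftMV z ℓ p) (shiftMV z ℓ p') ↔ MStep p p' := by
  simp only [MStep, shiftMV_fst_fst, shiftMV_fst_snd, shiftMV_snd]
  omega

/-- `shiftMV z ℓ` is injective. [folklore] -/
theorem shiftMV_injective (z : Site 2) (ℓ : ℤ) : Function.Injective (shiftMV z ℓ) := by
  intro p p' h
  have h1 := congrArg (fun x : MV => x.1.1) h; have h2 := congrArg (fun x : MV => x.1.2) h; have h3 := congrArg (fun x : MV => x.2) h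
  simp only [shiftMV_fst_fst, shiftMV_fst_snd, shiftMV_snd] at h1 h2 h3
  ext <;> omega

/-- Absolute admissibility from relative admissibility, the class of the reference level and the level range. [folklore] -/
theorem madm_shift {z : Site 2} {ℓ : ℤ} (hz : (3 : ℤ) ∣ ℓ - (z 0 + 2 * z 1)) {p : MV} (hp : RAdm p) (h0 : 0 ≤ ℓ + p.2) (hk : ℓ + p.2 ≤ k) :
    MAdm k (shiftMV z ℓ p) := by
  refine ⟨?_, by simpa using h0, by simpa using hk⟩
  simp only [shiftMV_snd, shiftMV_fst_fst, shiftMV_fst_snd]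
  have : ℓ + p.2 - (z 0 + p.1.1 + 2 * (z 1 + p.1.2)) = (ℓ - (z 0 + 2 * z 1)) + (p.2 - (p.1.1 + 2 * p.1.2)) := by ring
  rw [this]; exact dvd_add hz hp

/-- The reference level has the class of `z` iff `3 ∣ ℓ − (z₀ + 2z₁)`; from `ℓ % 3 = cls z`. [folklore] -/
theorem dvd_of_emod_eq_cls {z : Site 2} {ℓ : ℤ} (h : ℓ % 3 = (cls z : ℤ)) : (3 : ℤ) ∣ ℓ - (z 0 + 2 * z 1) := by
  unfold cls at h
  have h3 : (0 : ℤ) ≤ (z 0 - z 1) % 3 := Int.emod_nonneg _ (by norm_num)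
  rw [Int.toNat_of_nonneg h3] at h
  have := Int.emod_emod_of_dvd (z 0 - z 1) (dvd_refl (3 : ℤ))
  omega

/-- **A relative chain is a film path**: a non-empty, duplicate-free `MStep`-chain of relatively admissible vertices with absolute levels in `[0, k]`.
[cite: DuminilCopinSidoraviciusTassion2016, §2.3 (proof of Fact 2: the paths γ_u, γ_v, γ_w)] -/
theorem gpath_of_relchain {z : Site 2} {ℓ : ℤ} (hz : (3 : ℤ) ∣ ℓ - (z 0 + 2 * z 1)) {l : List MV} (hne : l ≠ []) (hadm : ∀ p ∈ l, RAdm p)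
    (hrange : ∀ p ∈ l, 0 ≤ ℓ + p.2 ∧ ℓ + p.2 ≤ k) (hch : l.IsChain MStep) (hnd : l.Nodup) :
    GPath (film k) (l.map (absV k z ℓ)) (absV k z ℓ (l.head hne)) (absV k z ℓ (l.getLast hne)) := by
  have hne' : l.map (shiftMV z ℓ) ≠ [] := by simpa using hne
  have h := gpath_of_mchain (k := k) hne' (fun p hp => ?_) ?_ ?_
  · have e1 : (l.map (shiftMV z ℓ)).map (toV k) = l.map (absV k z ℓ) := by simp [absV, Function.comp_def]
    rw [e1, List.head_map, List.getLast_map] at h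
    exact h
  · obtain ⟨q, hq, rfl⟩ := List.mem_map.1 hp
    exact madm_shift hz (hadm q hq) (hrange q hq).1 (hrange q hq).2
  · rw [List.isChain_map]; exact hch.imp fun a b hab => (mstep_shift_iff z ℓ a b).2 hab
  · exact hnd.map (shiftMV_injective z ℓ)

/-- The shadow of `absV`: the column `z + (a,b)`. [folklore] -/
theorem sh_absV {z : Site 2} {ℓ : ℤ} {p : MV} (h : MAdm k (shiftMV z ℓ p)) : sh (absV k z ℓ p) = z + ![p.1.1, p.1.2] := by
  rw [absV, sh_toV h]
  ext i; fin_cases i <;> simp [mcol]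

/-- The level of `absV`: `ℓ + λ`. [folklore] -/
theorem lev_absV {z : Site 2} {ℓ : ℤ} {p : MV} (h : MAdm k (shiftMV z ℓ p)) : lev ((absV k z ℓ p : slab111 k) : Site 3) = ℓ + p.2 := by
  rw [absV, lev_toV h]; rfl

/-- `absV` is injective on admissible data. [folklore] -/
theorem absV_inj {z : Site 2} {ℓ : ℤ} {p p' : MV} (h : MAdm k (shiftMV z ℓ p)) (h' : MAdm k (shiftMV z ℓ p')) (heq : absV k z ℓ p = absV k z ℓ p') :
    p = p' := shiftMV_injective z ℓ (toV_inj h h' heq)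

/-- A film vertex over the column `z + (a,b)` at level `ℓ + λ` IS `absV k z ℓ ((a,b),λ)`. [folklore] -/
theorem eq_absV_of_sh_lev {z : Site 2} {ℓ : ℤ} {p : MV} (h : MAdm k (shiftMV z ℓ p)) {x : slab111 k} (hs : sh x = z + ![p.1.1, p.1.2])
    (hl : lev (x : Site 3) = ℓ + p.2) : x = absV k z ℓ p :=
  eq_of_sh_eq_of_lev_eq (by rw [hs, sh_absV h]) (by rw [hl, lev_absV h])

/-! ## §2 Block membership in coordinates -/

/-- The triangular norm of an integer pair. [folklore] -/
def tnZ (q : ℤ × ℤ) : ℤ := max |q.1| (max |q.2| |q.1 + q.2|)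

/-- Membership of the relative column `q` in the relative clipped block `hexBall 0 3 ∩ {q₀ ≤ t} ∩ {q₀ + q₁ ≤ s}`. [folklore] -/
def inBlkB (t s : ℕ) (q : ℤ × ℤ) : Bool := decide (tnZ q ≤ 3) && decide (q.1 ≤ (t : ℤ)) && decide (q.1 + q.2 ≤ (s : ℤ))

/-- `triNorm` of `![a,b]` is `tnZ (a,b)`. [folklore] -/
theorem triNorm_vec (q : ℤ × ℤ) : triNorm (![q.1, q.2] : Site 2) = tnZ q := by simp [triNorm, tnZ]

/-- **Block membership from the coordinate test.** [folklore] -/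
theorem mem_blk_of_inBlkB {z : Site 2} {t s : ℕ} {q : ℤ × ℤ} (h : inBlkB t s q = true) : z + ![q.1, q.2] ∈ blk z t s := by
  simp only [inBlkB, Bool.and_eq_true, decide_eq_true_eq] at h
  refine ⟨?_, ?_, ?_⟩
  · rw [mem_hexBall, add_sub_cancel_left, triNorm_vec]; exact h.1.1
  · simp; exact h.1.2
  · simp; linarith [h.2]

/-- The coordinate test from block membership. [folklore] -/
theorem inBlkB_of_mem_blk {z : Site 2} {t s : ℕ} {q : ℤ × ℤ} (h : z + ![q.1, q.2] ∈ blk z t s) : inBlkB t s q = true := by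
  obtain ⟨h1, h2, h3⟩ := h
  rw [mem_hexBall, add_sub_cancel_left, triNorm_vec] at h1
  simp only [Pi.add_apply, Matrix.cons_val_zero, Matrix.cons_val_one] at h2 h3
  simp only [inBlkB, Bool.and_eq_true, decide_eq_true_eq]
  exact ⟨⟨h1, by linarith⟩, by linarith⟩

/-! ## §3 The peel table in coordinates -/

/-- **The level codes of a relative column** in the peel table of a block (key `(tR,tD,sR,sD,c0,kr)`, clip parameters capped inside `peelTab`). [folklore] -/
def codesAt (tR tD sR sD c0 kr : ℕ) (q : ℤ × ℤ) : List ℕ :=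
  (peelTab tR tD sR sD c0 kr).filterMap fun e => if e.1 = q then some e.2 else none

/-- Membership in `codesAt`. [folklore] -/
theorem mem_codesAt {tR tD sR sD c0 kr : ℕ} {q : ℤ × ℤ} {c : ℕ} : c ∈ codesAt tR tD sR sD c0 kr q ↔ (q, c) ∈ peelTab tR tD sR sD c0 kr := by
  simp only [codesAt, List.mem_filterMap]
  constructor
  · rintro ⟨e, he, h⟩
    split_ifs at h with hq
    · cases h; rw [← hq]; exact he
  · intro h; exact ⟨(q, c), h, by simp⟩

/-- **`Peeled` in coordinates**: a vertex over `z + q` is peeled iff one of the codes of `q` matches its level. [folklore] -/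
theorem peeled_iff_codes {z : Site 2} {tR tD sR sD : ℕ} {q : ℤ × ℤ} {x : slab111 k} (hs : sh x = z + ![q.1, q.2]) :
    Peeled k z tR tD sR sD x ↔ ∃ c ∈ codesAt tR tD sR sD (cls z) (k % 3) q, codeMatches c k (lev (x : Site 3)) := by
  constructor
  · rintro ⟨e, he, hsh, hc⟩
    refine ⟨e.2, mem_codesAt.2 ?_, hc⟩
    have hq : (e.1.1, e.1.2) = q := by
      rw [hs] at hsh
      have h0 := congrFun hsh 0; have h1 := congrFun hsh 1
      simp at h0 h1
      exact Prod.ext h0.symm h1.symm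
    have : e = (q, e.2) := by rw [← hq]
    rw [← this]; exact he
  · rintro ⟨c, hc, hm⟩
    exact ⟨(q, c), mem_codesAt.1 hc, by rw [hs], hm⟩

/-- At a middle level (`2 ≤ L ≤ k−2`) only code `4` can match. [folklore] -/
theorem codeMatches_mid {c : ℕ} {L : ℤ} (h2 : 2 ≤ L) (hk : L ≤ (k : ℤ) - 2) : codeMatches c k L ↔ c = 4 := by
  unfold codeMatches; omega

/-- At level `0` (`k ≥ 4`) only codes `0` and `4` can match. [folklore] -/
theorem codeMatches_zero {c : ℕ} (hk : 4 ≤ k) : codeMatches c k 0 ↔ c = 4 ∨ c = 0 := by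
  unfold codeMatches; omega

/-- At level `1` (`k ≥ 4`) only codes `1` and `4` can match. [folklore] -/
theorem codeMatches_one {c : ℕ} (hk : 4 ≤ k) : codeMatches c k 1 ↔ c = 4 ∨ c = 1 := by
  unfold codeMatches; omega

/-- At level `k−1` (`k ≥ 4`) only codes `2` and `4` can match. [folklore] -/
theorem codeMatches_sub_one {c : ℕ} (hk : 4 ≤ k) : codeMatches c k ((k : ℤ) - 1) ↔ c = 4 ∨ c = 2 := by
  unfold codeMatches; omega

/-- At level `k` (`k ≥ 4`) only codes `3` and `4` can match. [folklore] -/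
theorem codeMatches_top {c : ℕ} (hk : 4 ≤ k) : codeMatches c k k ↔ c = 4 ∨ c = 3 := by
  unfold codeMatches; omega

/-- **Not peeled at a middle level** when the column carries no code `4`. [folklore] -/
theorem not_peeled_of_mid {z : Site 2} {tR tD sR sD : ℕ} {q : ℤ × ℤ} {x : slab111 k} (hs : sh x = z + ![q.1, q.2])
    (h2 : 2 ≤ lev (x : Site 3)) (hk : lev (x : Site 3) ≤ (k : ℤ) - 2) (h4 : 4 ∉ codesAt tR tD sR sD (cls z) (k % 3) q) :
    ¬ Peeled k z tR tD sR sD x := by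
  rw [peeled_iff_codes hs]
  rintro ⟨c, hc, hm⟩
  rw [codeMatches_mid h2 hk] at hm
  exact h4 (hm ▸ hc)

/-- **Not peeled at a given level** when no code of the column matches that level (general form). [folklore] -/
theorem not_peeled_of_forall {z : Site 2} {tR tD sR sD : ℕ} {q : ℤ × ℤ} {x : slab111 k} (hs : sh x = z + ![q.1, q.2])
    (h : ∀ c ∈ codesAt tR tD sR sD (cls z) (k % 3) q, ¬ codeMatches c k (lev (x : Site 3))) : ¬ Peeled k z tR tD sR sD x := by
  rw [peeled_iff_codes hs]
  rintro ⟨c, hc, hm⟩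
  exact h c hc hm

/-! ## §4 Membership in the cleared set from coordinates -/

/-- **A vertex over a block column at a middle level is cleared** unless its column is fully peeled. [folklore] -/
theorem mem_Wset_of_mid {z : Site 2} {tR tD sR sD : ℕ} {q : ℤ × ℤ} {x : slab111 k} (hs : sh x = z + ![q.1, q.2]) (hb : inBlkB tD sD q = true)
    (h2 : 2 ≤ lev (x : Site 3)) (hk : lev (x : Site 3) ≤ (k : ℤ) - 2) (h4 : 4 ∉ codesAt tR tD sR sD (cls z) (k % 3) q) :
    x ∈ Wset k z tR tD sR sD :=
  ⟨by rw [hs]; exact mem_blk_of_inBlkB hb, not_peeled_of_mid hs h2 hk h4⟩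

/-- A cleared vertex over a column of `blk z tR sR` lies in `Wset ∩ lift (blkR 3 z tR sR)`. [folklore] -/
theorem mem_WsetR_of {z : Site 2} {tR tD sR sD : ℕ} {q : ℤ × ℤ} {x : slab111 k} (hs : sh x = z + ![q.1, q.2]) (hW : x ∈ Wset k z tR tD sR sD)
    (hR : inBlkB tR sR q = true) : x ∈ Wset k z tR tD sR sD ∩ (hexShadow k).lift (blkR 3 z tR sR) :=
  ⟨hW, by rw [HexShadow.mem_lift, hexShadow_sh, blkR_three, hs]; exact mem_blk_of_inBlkB hR⟩

end Slab111

end Summit.CriticalPhenomena.PercolationContinuityZ3.Theorems.Transplant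

end
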